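import Summits.ValiantsHypothesis.ValiantsHypothesis.Theorems.LacunarySymmetroidMatrixDescartesCensusDoorA34SquareLaw

/-!
# `MatrixDescartes` census — DOOR A at `(3,4)`: the FOUR-LETTER SQUARE LAW on SEPARATED supports
# (a proved deficiency-one law, uniform over the infinite support family `d₂ ≥ 2d₁`, `d₃ ≥ 2d₂`)

HONEST FRAMING.  Object-search cell `pub-symmetroid`, door-A seat `val-sym-door-p3` (g22); helper beside the OPEN item
stmt-ValiantsHypothesis-19980 `DoorA34 = PosRootLawAt 3 4 18` (asserted nowhere).  The sector treated here is tiny (its own Descartes bound is `9`,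
far below the door's `19`): nothing in this file bounds `ζ_sym(3,4)`; nothing bears on `MatrixDescartes` (stmt-ValiantsHypothesis-18050) or on `VP ≠ VNP`.

WHAT IS HERE (elementary).  On a four-letter alphabet `1, X^{d₁}, X^{d₂}, X^{d₃}` the UNIT HOLLOW-CROSS pencil `[[−1,0,1],[0,−M,L],[1,L,0]]`
(`L, M` in the span of the alphabet; a real symmetric `3 × 3` four-letter pencil, `unitHollowCross_pencil4_eq`) has determinant the SQUARE OBJECT
`L² + M`, a fewnomial on the `10` pair sums — Descartes bound `9`.  Writing the support as `(0, a, a+b, a+b+c)`: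

* **`card_posRoots_sq_add_le_eight` / `card_posRoots_unitHollowCross_pencil4_le_eight` (FOUR-LETTER SQUARE LAW).**  If the support is
  SEPARATED — `a ≤ b` and `a + b ≤ c`, i.e. `d₂ ≥ 2d₁` and `d₃ ≥ 2d₂` — then `L² + M` has AT MOST EIGHT distinct positive roots, for all real
  letters.  Proof: twisted Rolle (`Census.card_posRoots_le_card_posRoots_twists`) kills the four alphabet exponents AND the three cross exponents
  `d₁+d₂, d₁+d₃, d₂+d₃` (seven roots), and on a separated support the surviving pure-square form `A·X^{2d₁} + B·X^{2d₂} + C·X^{2d₃}` has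
  `A ≤ 0`, `B ≤ 0`, `C ≥ 0` (the signs of the twist weights are forced by the separation), hence at most one positive root
  (`card_posRoots_le_one_of_nonpos_nonneg'`).
* The three-letter case and the SHARP FAILURE of the law on non-separated supports (five roots of `(2000X²−653X³)² + (…)` on `(0,2,3)`) are in
  the companion file `…CensusDoorA34SquareLaw`.
READING (report HOME/DOOR-A34-P3G22-REPORT.md): a support-uniform deficiency law whose mechanism is «Rolle in the letters' Chebyshev space + one-signed
twisted top form»; the general count for `K` letters on separated supports is `Descartes − ⌈(K−2)/2⌉` (paper; here `K = 4`).

[folklore] Rolle's theorem in a Descartes system, elementary sign analysis; no single source.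
-/

-- `Summit.ValiantsHypothesis.ValiantsHypothesis.…` repeats a component by the D-0017 layout
-- (single-conjunct summit), which the `dupNamespace` linter flags; the name is mandated.
set_option linter.dupNamespace false

namespace Summit.ValiantsHypothesis.ValiantsHypothesis.Theorems.LacunarySymmetroidMatrixDescartes.Census.SquareLaw

open Polynomial Finset
open scoped BigOperators Polynomial

/-! ## 1. A pure-square top form with signs `(≤0, ≤0, ≥0)` has at most one positive root -/

/-- If `A ≤ 0 ≤ C` then `A·Xⁱ + B·X^{i+p} + C·X^{i+p+r}` (`p, r ≥ 1`, ANY middle coefficient `B`) has at most ONE distinct positive root: two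
roots `x₁ < x₂` give `A(x₂ᵖ − x₁ᵖ) = C·x₁ᵖx₂ᵖ(x₂ʳ − x₁ʳ)` with a non-positive left side and a non-negative right side, forcing `A = C = 0`, then
`B = 0`, and the zero polynomial has no roots.  (Generalises `card_posRoots_le_one_of_nonpos_nonneg` of the companion file to arbitrary gaps.) [folklore] -/
theorem card_posRoots_le_one_of_nonpos_nonneg' (i p r : ℕ) (hp : 0 < p) (hr : 0 < r) (A B Cc : ℝ)
    (hA : A ≤ 0) (hC : 0 ≤ Cc) :
    ((C A * X ^ i + C B * X ^ (i + p) + C Cc * X ^ (i + p + r)).roots.toFinset.filter (fun x => 0 < x)).card ≤ 1 := by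
  by_contra h
  push Not at h
  obtain ⟨x₁, hx₁, x₂, hx₂, hne⟩ := Finset.one_lt_card.mp h
  simp only [Finset.mem_filter, Multiset.mem_toFinset] at hx₁ hx₂
  have hp0 : C A * X ^ i + C B * X ^ (i + p) + C Cc * X ^ (i + p + r) ≠ 0 := fun h0 => by
    rw [h0, roots_zero] at hx₁; simp at hx₁
  have root_eq : ∀ x : ℝ, 0 < x → x ∈ (C A * X ^ i + C B * X ^ (i + p) + C Cc * X ^ (i + p + r)).roots →
      A + B * x ^ p + Cc * (x ^ p * x ^ r) = 0 := by
    intro x hx hmem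
    have hroot := (mem_roots hp0).mp hmem
    have ev : (C A * X ^ i + C B * X ^ (i + p) + C Cc * X ^ (i + p + r)).eval x
        = x ^ i * (A + B * x ^ p + Cc * (x ^ p * x ^ r)) := by
      simp only [eval_add, eval_mul, eval_C, eval_pow, eval_X]; ring1
    have h1 : x ^ i * (A + B * x ^ p + Cc * (x ^ p * x ^ r)) = 0 := by rw [← ev]; exact hroot
    rcases mul_eq_zero.mp h1 with h2 | h2
    · exact absurd h2 (pow_ne_zero _ hx.ne')
    · exact h2
  -- the ordered case
  have main : ∀ y₁ y₂ : ℝ, 0 < y₁ → y₁ < y₂ →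
      A + B * y₁ ^ p + Cc * (y₁ ^ p * y₁ ^ r) = 0 → A + B * y₂ ^ p + Cc * (y₂ ^ p * y₂ ^ r) = 0 → False := by
    intro y₁ y₂ hy₁ hlt e₁ e₂
    have hy₂ : 0 < y₂ := hy₁.trans hlt
    have key : A * (y₂ ^ p - y₁ ^ p) = Cc * (y₁ ^ p * y₂ ^ p) * (y₂ ^ r - y₁ ^ r) := by
      linear_combination (y₂ ^ p) * e₁ - (y₁ ^ p) * e₂
    have h1 : 0 < y₂ ^ p - y₁ ^ p := sub_pos.mpr (pow_lt_pow_left₀ hlt hy₁.le hp.ne')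
    have h2 : 0 < y₂ ^ r - y₁ ^ r := sub_pos.mpr (pow_lt_pow_left₀ hlt hy₁.le hr.ne')
    have h3 : 0 < y₁ ^ p * y₂ ^ p := mul_pos (pow_pos hy₁ p) (pow_pos hy₂ p)
    have hL : A * (y₂ ^ p - y₁ ^ p) ≤ 0 := mul_nonpos_of_nonpos_of_nonneg hA h1.le
    have hR : 0 ≤ Cc * (y₁ ^ p * y₂ ^ p) * (y₂ ^ r - y₁ ^ r) := by positivity
    have hA0 : A = 0 := by
      have h0 : A * (y₂ ^ p - y₁ ^ p) = 0 := le_antisymm hL (key ▸ hR)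
      rcases mul_eq_zero.mp h0 with h' | h'
      · exact h'
      · exact absurd h' h1.ne'
    have hC0 : Cc = 0 := by
      have h0 : Cc * (y₁ ^ p * y₂ ^ p) * (y₂ ^ r - y₁ ^ r) = 0 := by rw [← key, hA0, zero_mul]
      rcases mul_eq_zero.mp h0 with h' | h'
      · rcases mul_eq_zero.mp h' with h'' | h''
        · exact h''
        · exact absurd h'' h3.ne'
      · exact absurd h' h2.ne'
    have hB0 : B = 0 := by
      have h0 : B * y₁ ^ p = 0 := by
        have := e₁; rw [hA0, hC0] at this; linarith
      rcases mul_eq_zero.mp h0 with h' | h'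
      · exact h'
      · exact absurd h' (pow_ne_zero _ hy₁.ne')
    apply hp0
    rw [hA0, hB0, hC0]
    simp
  obtain ⟨hr₁, hpos₁⟩ := hx₁
  obtain ⟨hr₂, hpos₂⟩ := hx₂
  rcases lt_or_gt_of_ne hne with hlt | hlt
  · exact main x₁ x₂ hpos₁ hlt (root_eq x₁ hpos₁ hr₁) (root_eq x₂ hpos₂ hr₂)
  · exact main x₂ x₁ hpos₂ hlt (root_eq x₂ hpos₂ hr₂) (root_eq x₁ hpos₁ hr₁)

/-! ## 2. The four-letter square object as a ten-term fewnomial -/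

/-- Expansion of `L² + M` on the alphabet `(0, a, a+b, a+b+c)` as a ten-term fewnomial on the pair sums
`0, a, a+b, a+b+c, 2a, 2a+b, 2a+2b, 2a+b+c, 2a+2b+c, 2a+2b+2c`. [folklore] -/
theorem sq_add_eq_sum4 (a b c : ℕ) (w u₁ u₂ u₃ m₀ m₁ m₂ m₃ : ℝ) :
    (C w + C u₁ * X ^ a + C u₂ * X ^ (a + b) + C u₃ * X ^ (a + b + c)) ^ 2
        + (C m₀ + C m₁ * X ^ a + C m₂ * X ^ (a + b) + C m₃ * X ^ (a + b + c))
      = ∑ t : Fin 10, C ((![w ^ 2 + m₀, 2 * u₁ * w + m₁, 2 * u₂ * w + m₂, 2 * u₃ * w + m₃, u₁ ^ 2, 2 * u₁ * u₂, u₂ ^ 2,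
            2 * u₁ * u₃, 2 * u₂ * u₃, u₃ ^ 2] : Fin 10 → ℝ) t)
          * X ^ ((![0, a, a + b, a + b + c, 2 * a, 2 * a + b, 2 * a + 2 * b, 2 * a + b + c, 2 * a + 2 * b + c,
            2 * a + 2 * b + 2 * c] : Fin 10 → ℕ) t) := by
  simp only [Fin.sum_univ_succ, Fin.sum_univ_zero, Matrix.cons_val_zero, Matrix.cons_val_succ,
    map_add, map_mul, map_pow, map_ofNat, pow_zero, mul_one, add_zero]
  ring1

/-! ## 3. THE FOUR-LETTER SQUARE LAW on separated supports -/

/-- **FOUR-LETTER SQUARE LAW (separated supports).**  On the alphabet `1, X^a, X^{a+b}, X^{a+b+c}` with `0 < a ≤ b` and `a + b ≤ c`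
(equivalently `d₂ ≥ 2d₁`, `d₃ ≥ 2d₂`), for all real letters the square object `(w + u₁X^a + u₂X^{a+b} + u₃X^{a+b+c})² + (m₀ + m₁X^a + m₂X^{a+b} + m₃X^{a+b+c})`
— ten monomials, Descartes bound nine — has AT MOST EIGHT distinct positive roots.  Seven Euler twists kill the alphabet and the three cross
exponents; the surviving form `A·X^{2a} + B·X^{2a+2b} + C·X^{2a+2b+2c}` has
`A = −2a²(b−a)·b(b+c−a)·(b+c)(2b+c)·u₁² ≤ 0` and `C ≥ 0` (also `B = −(2a+2b)(a+2b)(a+b)·b·(c−a−b)(c−b)c·u₂² ≤ 0`, not needed). [folklore] -/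
theorem card_posRoots_sq_add_le_eight (a b c : ℕ) (ha : 0 < a) (hab : a ≤ b) (habc : a + b ≤ c)
    (w u₁ u₂ u₃ m₀ m₁ m₂ m₃ : ℝ) :
    ((((C w + C u₁ * X ^ a + C u₂ * X ^ (a + b) + C u₃ * X ^ (a + b + c)) ^ 2
        + (C m₀ + C m₁ * X ^ a + C m₂ * X ^ (a + b) + C m₃ * X ^ (a + b + c))).roots.toFinset.filter
      (fun x => 0 < x)).card) ≤ 8 := by
  rw [sq_add_eq_sum4]
  set e : Fin 10 → ℕ := ![0, a, a + b, a + b + c, 2 * a, 2 * a + b, 2 * a + 2 * b, 2 * a + b + c, 2 * a + 2 * b + c,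
    2 * a + 2 * b + 2 * c] with he
  set cf : Fin 10 → ℝ := ![w ^ 2 + m₀, 2 * u₁ * w + m₁, 2 * u₂ * w + m₂, 2 * u₃ * w + m₃, u₁ ^ 2, 2 * u₁ * u₂, u₂ ^ 2,
    2 * u₁ * u₃, 2 * u₂ * u₃, u₃ ^ 2] with hcf
  have step := Census.card_posRoots_le_card_posRoots_twists e cf ({0, 1, 2, 3, 5, 7, 8} : Finset (Fin 10))
  have hU : ({0, 1, 2, 3, 5, 7, 8} : Finset (Fin 10)).card = 7 := by decide
  rw [hU] at step
  -- the surviving pure-square form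
  set A : ℝ := -(u₁ ^ 2 * (2 * (a : ℝ) * a) * ((b : ℝ) - a) * ((b : ℝ) * ((b : ℝ) + c - a)) * (((b : ℝ) + c) * (2 * (b : ℝ) + c)))
    with hA
  set B : ℝ := -(u₂ ^ 2 * ((2 * (a : ℝ) + 2 * b) * ((a : ℝ) + 2 * b) * ((a : ℝ) + b)) * (b : ℝ) * (((c : ℝ) - a - b) * ((c : ℝ) - b) * c))
    with hB
  set Cc : ℝ := u₃ ^ 2 * ((2 * (a : ℝ) + 2 * b + 2 * c) * ((a : ℝ) + 2 * b + 2 * c) * ((a : ℝ) + b + 2 * c) * ((a : ℝ) + b + c)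
      * ((b : ℝ) + 2 * c) * ((b : ℝ) + c) * c) with hCc
  have htw : (∑ t : Fin 10, C (cf t * ∏ u' ∈ ({0, 1, 2, 3, 5, 7, 8} : Finset (Fin 10)), ((e t : ℝ) - e u')) * X ^ (e t))
      = C A * X ^ (2 * a) + C B * X ^ (2 * a + 2 * b) + C Cc * X ^ (2 * a + 2 * b + 2 * c) := by
    have hprod : ∀ t : Fin 10, ∏ u' ∈ ({0, 1, 2, 3, 5, 7, 8} : Finset (Fin 10)), ((e t : ℝ) - e u')
        = ((e t : ℝ) - e 0) * (((e t : ℝ) - e 1) * (((e t : ℝ) - e 2) * (((e t : ℝ) - e 3) * (((e t : ℝ) - e 5)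
            * (((e t : ℝ) - e 7) * ((e t : ℝ) - e 8)))))) := by
      intro t
      rw [Finset.prod_insert (by decide), Finset.prod_insert (by decide), Finset.prod_insert (by decide),
        Finset.prod_insert (by decide), Finset.prod_insert (by decide), Finset.prod_insert (by decide),
        Finset.prod_singleton]
    simp only [hprod]
    simp only [Fin.sum_univ_succ, Fin.sum_univ_zero, he, hcf, Matrix.cons_val_zero, Matrix.cons_val_succ,
      Matrix.cons_val_one]
    simp only [hA, hB, hCc]
    push_cast
    simp only [sub_self, sub_zero, mul_zero, zero_mul, map_zero, zero_add, add_zero, map_mul, map_neg, map_sub, map_add,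
      map_pow, map_ofNat]
    ring1
  rw [htw] at step
  have ha' : (0 : ℝ) < a := by exact_mod_cast ha
  have hab' : (a : ℝ) ≤ b := by exact_mod_cast hab
  have habc' : (a : ℝ) + b ≤ c := by exact_mod_cast habc
  have hb0 : (0 : ℝ) ≤ b := by positivity
  have hc0 : (0 : ℝ) ≤ c := by positivity
  have hAle : A ≤ 0 := by
    rw [hA, neg_nonpos]
    have h1 : (0 : ℝ) ≤ (b : ℝ) - a := by linarith
    have h2 : (0 : ℝ) ≤ (b : ℝ) + c - a := by linarith
    have h3 : (0 : ℝ) ≤ (b : ℝ) * ((b : ℝ) + c - a) := mul_nonneg hb0 h2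
    have h4 : (0 : ℝ) ≤ ((b : ℝ) + c) * (2 * (b : ℝ) + c) := by positivity
    have h5 : (0 : ℝ) ≤ u₁ ^ 2 * (2 * (a : ℝ) * a) := by positivity
    have h6 := mul_nonneg (mul_nonneg (mul_nonneg h5 h1) h3) h4
    exact h6
  have hCge : 0 ≤ Cc := by rw [hCc]; positivity
  have hb : 0 < b := lt_of_lt_of_le ha hab
  have hc : 0 < c := lt_of_lt_of_le (Nat.add_pos_left ha b) habc
  have top := card_posRoots_le_one_of_nonpos_nonneg' (2 * a) (2 * b) (2 * c) (by omega) (by omega) A B Cc hAle hCge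
  have e2 : 2 * a + 2 * b + 2 * c = 2 * a + 2 * b + 2 * c := rfl
  omega

/-! ## 4. Pencil form: an eight-parameter sector of the symmetric `3 × 3` FOUR-letter format -/

/-- The four symmetric letters of the unit hollow-cross pencil on the alphabet `(0, a, a+b, a+b+c)`. [folklore] -/
theorem unitHollowCross_pencil4_eq (a b c : ℕ) (w u₁ u₂ u₃ m₀ m₁ m₂ m₃ : ℝ) :
    (∑ l : Fin 4, (X : ℝ[X]) ^ ((![0, a, a + b, a + b + c] : Fin 4 → ℕ) l) •
        ((![!![-1, 0, 1; 0, -m₀, w; 1, w, 0], !![0, 0, 0; 0, -m₁, u₁; 0, u₁, 0], !![0, 0, 0; 0, -m₂, u₂; 0, u₂, 0],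
            !![0, 0, 0; 0, -m₃, u₃; 0, u₃, 0]] : Fin 4 → Matrix (Fin 3) (Fin 3) ℝ) l).map C)
      = !![-1, 0, 1;
           0, -(C m₀ + C m₁ * X ^ a + C m₂ * X ^ (a + b) + C m₃ * X ^ (a + b + c)),
              C w + C u₁ * X ^ a + C u₂ * X ^ (a + b) + C u₃ * X ^ (a + b + c);
           1, C w + C u₁ * X ^ a + C u₂ * X ^ (a + b) + C u₃ * X ^ (a + b + c), 0] := by
  refine Matrix.ext fun i j => ?_
  fin_cases i <;> fin_cases j <;>
    simp [Matrix.sum_apply, Fin.sum_univ_four, Matrix.smul_apply, Matrix.map_apply]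
  ring1

/-- **FOUR-LETTER SQUARE LAW, pencil form.**  The real symmetric FOUR-letter `3 × 3` pencil with letters
`S₀ = [[−1,0,1],[0,−m₀,w],[1,w,0]]`, `S_l = [[0,0,0],[0,−m_l,u_l],[0,u_l,0]]` (`l = 1,2,3`) on a SEPARATED support `(0, a, a+b, a+b+c)`,
`0 < a ≤ b`, `a + b ≤ c`, has at most EIGHT distinct positive roots of its determinant (Descartes bound of the sector: nine) — a support-uniform
deficiency-one law on an eight-parameter sector of the `(3,4)` format (the format of `DoorA34`, which asks `≤ 18` for all `24`-parameter
pencils and is NOT touched by this). [folklore] -/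
theorem card_posRoots_unitHollowCross_pencil4_le_eight (a b c : ℕ) (ha : 0 < a) (hab : a ≤ b) (habc : a + b ≤ c)
    (w u₁ u₂ u₃ m₀ m₁ m₂ m₃ : ℝ) :
    ((Matrix.det (∑ l : Fin 4, (X : ℝ[X]) ^ ((![0, a, a + b, a + b + c] : Fin 4 → ℕ) l) •
        ((![!![-1, 0, 1; 0, -m₀, w; 1, w, 0], !![0, 0, 0; 0, -m₁, u₁; 0, u₁, 0], !![0, 0, 0; 0, -m₂, u₂; 0, u₂, 0],
            !![0, 0, 0; 0, -m₃, u₃; 0, u₃, 0]] : Fin 4 → Matrix (Fin 3) (Fin 3) ℝ) l).map C)).roots.toFinset.filter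
      (fun x => 0 < x)).card ≤ 8 := by
  rw [unitHollowCross_pencil4_eq, det_unitHollowCross]
  exact card_posRoots_sq_add_le_eight a b c ha hab habc w u₁ u₂ u₃ m₀ m₁ m₂ m₃

end Summit.ValiantsHypothesis.ValiantsHypothesis.Theorems.LacunarySymmetroidMatrixDescartes.Census.SquareLaw
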